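import Summits.BirchSwinnertonDyer.BirchSwinnertonDyer.Theorems.SemiOrdinaryEisensteinDescentEisensteinKernelAtThreeOfValueAtOneV
import HarnessLib

/-!
# Route `SemiOrdinaryEisensteinDescent`, crux #2″ `WildSplitEisensteinValueAtOneV` (`E_𝟙^V`, stmt-BirchSwinnertonDyer-26610):
# the STEP-L NORMAL FORM of the crux, and the `W`-free kernel
# (cell `pub/bsd-wall`, width seat `bsd-wall-soed-p1-w3` g13, `--supports stmt-BirchSwinnertonDyer-26610`, helper)

WHY. Since route rev 23 (act G′-V) the Eisenstein crux of the deciding chain is `E_𝟙^V`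
(`Theses.SemiOrdinaryEisensteinDescent.WildSplitEisensteinValueAtOneV`): at every BDP frame over an ODD Heegner
field of the cell carrying a unit value display `L(𝟙) = u·(log_{ω,𝔭} P/c)²`, every characteristic generator `f`
of `X_(∅,0)` at `𝔭′` has `‖f(𝟙)‖₃ ≤ ‖L(𝟙)‖`. The `closes` kernel (p609065 §1, w2 g12) consumes it at ONE frame and
ONLY to produce the Heegner-side STEP-L socket at the Manin slack,

  `L₃ʷ°`:  `SchneiderFree.IndexLowerBoundLeAt W 3 K P (v₃ c)`, i.e. `2·ord₃[E(K):ℤP] ≤ ord₃ #Ш(E/K) + 2·ord₃ ∏_ℓ c_ℓ(E) + 2·v₃(c)`,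

on the odd Friedberg–Hoffstein data of the cell (displayed below as `hL`: `E_𝟙^V`'s first ten antecedents
verbatim, conclusion the socket). This file records, kernel-checked, that modulo the route's PRINT-SIDE items the new
crux IS that socket — nothing Λ-adic and nothing about the BDP `L`-function survives:

* §1 `stepL_of_valueAtOneV` — **`E_𝟙^V` (BY NAME) → Kolyvagin → W (24476) → PT1 (20461) → `L₃ʷ°`**: p609065 §1 part (b)
  extracted as a theorem (frame from print via the CLOSED item 24475, unit value forced by LZZ, control `≤` at `𝔭′`
  from Poitou–Tate alone, w2 g4's `imcLowerLe_iff_forall_norm_constantCoeff_le`, the `≤`-link).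
* §2 `valueAtOneV_of_stepL_of_control` — **`L₃ʷ°` → Kolyvagin → W → C (20386, aside) → `E_𝟙^V` (BY NAME)**: w2 g4's
  necessity certificate `Tight.valueAtOneV_of_wAllExclAddWildRankOneSurj` FACTORED THROUGH `L₃ʷ°` (there the socket
  came from the leaf + Z via two `BSD₃`'s; here it is the hypothesis), so the leaf and Z drop out of the converse.
* §3 `valueAtOneV_iff_stepL` — **modulo {Kolyvagin, W 24476, PT1 20461, C 20386}: `E_𝟙^V` ⟺ `L₃ʷ°`.** Reading for the
  pen / the vet of 26610: the crux's content is the `3`-part-of-BSD lower bound over `K` in Heegner-index currency at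
  the odd Friedberg–Hoffstein data; its NECESSITY for the rung holds modulo PUB + Z alone in `L₃ʷ°`-form
  (`WildKolyvaginUpperAtThreeTight.indexBounds_of_bsdp_of_partner_bsdp`), and modulo PUB + Z + C in `E_𝟙^V`-form (§2).
* §4 `wAllExclAddWildRankOneSurj_of_stepL_of_sigmaMultiCarrier_of_jetchevMaxModThree_of_primitives_of_poitouTate` —
  **the `W`-FREE kernel**: `PublishedInputsWildThree → L₃ʷ° → KolyvaginPrimitivesAtThree → JetchevMaxDivisibilityAtThreeModThree
  → WildSigmaDivisibilityAtThreeMultiCarrier → PoitouTateSelmerStructureDualityFact → WildRankZeroTwistAtThree →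
  WAllExclAddWildRankOneSurj` — p609065 §3 with the Eisenstein step fed by `L₃ʷ°` directly: the frame item 24475, the
  printed-inputs binder W 24476 (Hsieh 2014 Thm A ∧ BDP 2013 Thm 5.5 ∧ LZZ 2018, three named print facts at an
  additive prime) and the `E`-side use of PT1 are needed only to STATE crux #2 in Eisenstein language, not for the rung
  (PT stays on the Kolyvagin side through the Jetchev max-form glue `hGJ hPTc`).

HONEST FRAMING: bookkeeping, CONDITIONAL on every displayed antecedent; `L₃ʷ°` / `E_𝟙^V` are research-open (no
Eisenstein engine at an additive potentially supersingular `3`: walls W1–W3 of `Cruxes/WildSplitEisensteinInclusionAtThree/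
Lines/birth-dead*.md`; indivisibility road = T1⁻ open), `J‴` and Z are research, the rest is print; no crux is claimed
false; closes nothing; BSD₃ is proved for no curve by this file. No definition, no named fact, no `sorry`.

References: [JetchevSkinnerWan2017] Thm. 3.3.1, §7.4.1 (arXiv:1512.06894 pp. 11, 30); [GrossZagier1986] I.(6.3), V §2;
[FriedbergHoffstein1995] Thm. B; [Kolyvagin1990] Thm. A; [MilneADT2006] I Thm. 4.10(b); [LiuZhangZhang2018] Thm 1.5.1/1.5.3;
[Castella2018] Thm. 2.3, §5; [McCallumLMS1991] §3; [GrossLMS1991] Prop. 3.7(2), §6; [Jetchev2008] Thm. 1.4.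
-/

noncomputable section

open scoped Classical NumberField

set_option linter.dupNamespace false -- `Summit.BirchSwinnertonDyer.BirchSwinnertonDyer.Theorems.…` (summit = sub, D-0017)
set_option autoImplicit false

namespace Summit.BirchSwinnertonDyer.BirchSwinnertonDyer.Theorems.WildSplitEisensteinValueAtOneVStepLNormalForm

open WeierstrassCurve NumberField IsDedekindDomain Field PowerSeries
  Literature.NumberTheory.EllipticCurves
  Literature.NumberTheory.EllipticCurves.ModularForms
  Literature.NumberTheory.EllipticCurves.Rank1Residual
  Literature.NumberTheory.EllipticCurves.KrizLi2019
  Literature.NumberTheory.GaloisCohomology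
  Summit.BirchSwinnertonDyer.Rank1Residual
  Summit.BirchSwinnertonDyer.Rank1Residual.Additive
  Summit.BirchSwinnertonDyer.Rank1Residual.X11b
  Summit.BirchSwinnertonDyer.Rank1Residual.X11b.AcSelmer
  Summit.BirchSwinnertonDyer.Rank1Residual.X11b.Halves
  Summit.BirchSwinnertonDyer.BirchSwinnertonDyer.Theses.SemiOrdinaryEisensteinDescent
  Summit.BirchSwinnertonDyer.BirchSwinnertonDyer.Theorems

/-! ### §1 `E_𝟙^V ⟹ L₃ʷ°` given Kolyvagin, the printed frame inputs W and PT1 (the kernel's consumption, extracted) -/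

/-- **`E_𝟙^V → Kolyvagin → W → PT1 → L₃ʷ°`.** At every datum of the cell over an ODD Heegner field with
`L(E^{(d_K)},1) ≠ 0` and `P = y_K` of infinite order, the new crux `E_𝟙^V` (by name) yields the STEP-L socket at
the Manin slack, `SchneiderFree.IndexLowerBoundLeAt W 3 K P (v₃ c)`: pick an anticyclotomic frame `(κ, γ)`, the two
degree-one primes `𝔭 ≠ 𝔭′` above the split `3`, the `R₀`-frame at `𝔭` from print (item 24475, CLOSED, fed by the first
two conjuncts of W) with its unit value forced by LZZ (third conjunct), the control INEQUALITY at `𝔭′` from PT1 alone,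
read `E_𝟙^V` at that frame through w2 g4's `imcLowerLe_iff_forall_norm_constantCoeff_le` as T-B6-1 at slack `v₃(c)`,
and apply the `≤`-link. This is p609065 §1 part (b) verbatim, isolated. CONDITIONAL; nothing asserted about any curve.
[cite: JetchevSkinnerWan2017, Thm. 3.3.1 and §7.4.1 (arXiv:1512.06894 pp. 11, 30)]
[cite: LiuZhangZhang2018, Thm 1.5.1 and Thm 1.5.3 (Duke Math. J. 167 pp. 748–749)] [cite: MilneADT2006, Ch. I, Thm. 4.10(b)] -/
theorem stepL_of_valueAtOneV (hE1V : WildSplitEisensteinValueAtOneV)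
    (hKo : ∀ (N : ℕ) [NeZero N] (W : WeierstrassCurve ℚ) (K : Type) [Field K] [NumberField K],
      Literature.NumberTheory.EllipticCurves.kolyvagin N W K)
    (hW : WildSplitPrintedInputsAtThree) (hPT : PoitouTateSelmerStructureDualityFact) :
    ∀ (W : WeierstrassCurve ℚ) [W.IsElliptic] [W.IsGloballyMinimal] (N : ℕ) [NeZero N] (K : Type) [Field K]
      [NumberField K] (Dt : ModularParametrizationData W N) (H : HeegnerDatum N (NumberField.discr K)) (ι : K →+* ℂ)
      (P : (W.baseChange K).toAffine.Point), ClassO6 W 3 → W.HasSurjectiveModNGaloisRep 3 → W.analyticRank = 1 →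
      W.conductorNorm ℤ = N → IsImaginaryQuadratic K → SatisfiesHeegnerHypothesis N K →
      (W.quadraticTwist (NumberField.discr K : ℚ)).entireLFunction 1 ≠ 0 →
      WeierstrassCurve.Affine.Point.map ι.toRatAlgHom P = heegnerPointComplex Dt H → ¬ IsOfFinAddOrder P →
      Odd (NumberField.discr K) → SchneiderFree.IndexLowerBoundLeAt W 3 K P (padicValNat 3 Dt.c.natAbs) := by
  intro W _ _ N _ K _ _ Dt H ι P hO6 hsurj hr hN hK hHN hLt hP hnt hodd
  subst hN
  obtain ⟨hH, hB, hLZZ⟩ := hW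
  -- Kolyvagin: `rank E(K) = 1`, `Ш(E/K)` finite
  obtain ⟨hrk, hfin⟩ := hKo (W.conductorNorm ℤ) W K hK hHN ⟨Dt, H, ι, hP⟩ hnt
  -- `3 ∣ N(E)` (additive) splits in `K`
  have h3N : 3 ∣ W.conductorNorm ℤ :=
    (W.dvd_conductorNorm_iff_not_hasGoodReductionAtPrime 3).mpr (not_good_of_addv W 3 hO6.2.1)
  have hsplit : SplitsIn K 3 := hHN 3 Nat.prime_three h3N
  -- a frame `(κ, γ, 𝔭)` and the other prime `𝔭′ ≠ 𝔭` above `3`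
  obtain ⟨κ, γ, -, hκ, hγ, -⟩ := X11b.exists_anticyclotomic_generator_prime (p := 3) hK
  haveI : Fact (κ.IsTopGenerator γ) := ⟨hγ⟩
  obtain ⟨𝔭, h𝔭, he, hf⟩ := X11b.exists_degreeOnePrime_of_splitsIn K 3 hK.1 hsplit
  obtain ⟨𝔭', hne, h𝔭', he', hf'⟩ := X11b.Three.exists_ne_degreeOne_prime hK.1 h𝔭 he hf
  -- the `R₀`-frame at `(κ, γ, 𝔭)` FROM PRINT (item 24475, closed) and its unit value, FORCED by the LZZ input
  obtain ⟨ι', hind, ΩK, Ωp, L, hΩK, hΩp, hBDP⟩ :=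
    wildSplitFrameAtThreeOddOfPrint_proof hH hB W (W.conductorNorm ℤ) K Dt hO6 rfl hK hHN hodd κ hκ γ 𝔭 h𝔭
  obtain ⟨u, hval⟩ := EisensteinKernelAtThreeRestrictedOfFrameOdd.exists_unit_hasValueAt_of_frame hLZZ W
    (W.conductorNorm ℤ) K Dt H ι P hO6 rfl hK hHN hP hnt κ hκ γ 𝔭 h𝔭 he hf ι' hind hΩK hΩp hBDP
  -- the control INEQUALITY at `𝔭′` at slack `0` (CTL₀ included), from Poitou–Tate duality for Selmer structures ALONE
  have hctl : SchneiderFreeControlAtoms.AdditiveControlLeOnTreeAt 3 κ 𝔭' γ (embAt K 3 𝔭' h𝔭' he' hf') 0 P :=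
    AdditiveRankOneControlLe.additiveControlLeOnTreeAt_of_poitouTate_of_heegner W 3 (by norm_num) hO6.2.1
      (W.conductorNorm ℤ) K (hPT K) Dt H ι P rfl hK hHN hP hnt (hKo _ W K) κ hκ γ 𝔭' h𝔭' he' hf'
  obtain ⟨n, hn, hnle⟩ := hctl
  -- the value read through the logarithm at `𝔭′` (rank one: `(log_{𝔭′} P)² = (log_𝔭 P)²`)
  have hval' : L.HasValueAt 0 ((((u : unrIntegers 3) : unrIntegers 3) : ℂ_[3]) *
      (algebraMap ℚ_[3] ℂ_[3] (logOmega W 3 (embAt K 3 𝔭' h𝔭' he' hf') P / (Dt.c : ℚ_[3]))) ^ 2) :=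
    (SchneiderFreeAdditiveX3.hasValueAt_sq_logOmega_embAt_iff_of_rank_one W 3 hK.1 hrk h𝔭 he hf
      h𝔭' he' hf' P _ _ L).mpr hval
  -- `E_𝟙^V` at this frame and this unit value = T-B6-1 at slack `v₃(c)` (given the CTL₀ `hn`)
  have hc0 : Dt.c ≠ 0 := Dt.maninConstant_ne_zero_holds
  have hlog : logOmega W 3 (embAt K 3 𝔭' h𝔭' he' hf') P ≠ 0 := X11b.R1.logOmega_ne_zero W 3 _ hnt
  have hlow : SchneiderFree.AdditiveIMCLowerBDPOnTreeLeAt 3 κ 𝔭' γ (embAt K 3 𝔭' h𝔭' he' hf')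
      (padicValNat 3 Dt.c.natAbs) P :=
    (WildSplitEisensteinInclusionAtThreeTight.imcLowerLe_iff_forall_norm_constantCoeff_le hc0 hlog hn u hval').mpr
      (fun f hfI ↦ hE1V W (W.conductorNorm ℤ) K Dt H ι P hO6 hsurj hr rfl hK hHN hLt hP hnt hodd κ hκ γ 𝔭 h𝔭 he hf 𝔭'
        h𝔭' hne ι' hind ΩK Ωp L hΩK hΩp hBDP hn.1 u hval f hfI)
  -- the `≤`-link: T-B6-1 at slack `v₃(c)` + control `≤` at slack `0` ⟹ STEP L at slack `v₃(c)`
  exact AdditiveRankOneControlLe.indexLowerBoundLeAt_of_imcLowerLe_of_controlLe_zero rfl hK hHN hfin hlow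
    ⟨n, hn, hnle⟩

/-! ### §2 `L₃ʷ° ⟹ E_𝟙^V` given Kolyvagin, W and the control EQUALITY C (Tight §3 factored through the socket) -/

/-- **`L₃ʷ° → Kolyvagin → LZZ → C → E_𝟙^V`.** Conversely, the STEP-L socket at the Manin slack on the odd
Friedberg–Hoffstein data (displayed hypothesis `hL`), Kolyvagin's finiteness, and the control EQUALITY at `𝔭′` (crux #5
`WildSplitControlAtThree`, item 20386, aside; the UTD copy is split into seven print leaves + glue, p526934) give the new
crux `E_𝟙^V` BY NAME: at a frame of `E_𝟙^V`'s shape, `hL` and the control count give T-B6-1 at slack `v₃(c)`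
(K1 door `SchneiderFreeAdditiveX3.additiveIMCLowerBDPOnTreeLeAt_of_indexLowerBoundLeAt_of_control`), and the displayed
unit value, moved from `𝔭` to `𝔭′` in rank one, turns it into the norm inequality (Tight §2). This is w2 g4's
`Tight.valueAtOneV_of_wAllExclAddWildRankOneSurj` with «leaf + Z ⟹ socket» replaced by the socket itself; the LZZ
input is not even needed here (the display is a hypothesis of `E_𝟙^V`). CONDITIONAL; nothing asserted about any curve.
[cite: JetchevSkinnerWan2017, §7.4.1 (arXiv:1512.06894 p. 30)] [cite: Castella2018, Thm. 2.3 and §5 (5.1)–(5.3)] -/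
theorem valueAtOneV_of_stepL_of_control
    (hL : ∀ (W : WeierstrassCurve ℚ) [W.IsElliptic] [W.IsGloballyMinimal] (N : ℕ) [NeZero N] (K : Type) [Field K]
      [NumberField K] (Dt : ModularParametrizationData W N) (H : HeegnerDatum N (NumberField.discr K)) (ι : K →+* ℂ)
      (P : (W.baseChange K).toAffine.Point), ClassO6 W 3 → W.HasSurjectiveModNGaloisRep 3 → W.analyticRank = 1 →
      W.conductorNorm ℤ = N → IsImaginaryQuadratic K → SatisfiesHeegnerHypothesis N K →
      (W.quadraticTwist (NumberField.discr K : ℚ)).entireLFunction 1 ≠ 0 →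
      WeierstrassCurve.Affine.Point.map ι.toRatAlgHom P = heegnerPointComplex Dt H → ¬ IsOfFinAddOrder P →
      Odd (NumberField.discr K) → SchneiderFree.IndexLowerBoundLeAt W 3 K P (padicValNat 3 Dt.c.natAbs))
    (hKo : ∀ (N : ℕ) [NeZero N] (W : WeierstrassCurve ℚ) (K : Type) [Field K] [NumberField K],
      Literature.NumberTheory.EllipticCurves.kolyvagin N W K)
    (hC : WildSplitControlAtThree) : WildSplitEisensteinValueAtOneV := by
  intro W _ _ N _ K _ _ Dt H ι P hO6 hsurj hr hN hK hHH hLt hP hnt hodd κ hκ γ _ 𝔭 h𝔭 he hf 𝔭' h𝔭' hne ι' hι'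
    ΩK Ωp L hΩK hΩp hBDP htor u hval f hfI
  -- the socket at this datum (hypothesis)
  have hlo : SchneiderFree.IndexLowerBoundLeAt W 3 K P (padicValNat 3 Dt.c.natAbs) :=
    hL W N K Dt H ι P hO6 hsurj hr hN hK hHH hLt hP hnt hodd
  -- `𝔭′` has degree one (`3 ∣ N` splits in `K`)
  have h3N : 3 ∣ W.conductorNorm ℤ :=
    (W.dvd_conductorNorm_iff_not_hasGoodReductionAtPrime 3).mpr (not_good_of_addv W 3 hO6.2.1)
  have hpN : 3 ∣ N := hN ▸ h3N
  obtain ⟨he', hf'⟩ :=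
    Literature.NumberTheory.EllipticCurves.ramificationIdx_eq_one_and_inertiaDeg_eq_one_of_ncard_primesOver_eq_two
      3 hK.1 (hHH 3 Nat.prime_three hpN) 𝔭' h𝔭'
  -- Kolyvagin: `rank E(K) = 1`, `Ш(E/K)` finite; the control EQUALITY at `𝔭′` (crux #5, antecedent)
  obtain ⟨hrk, hfin⟩ := hKo N W K hK hHH ⟨Dt, H, ι, hP⟩ hnt
  have hctl : SchneiderFree.AdditiveControlOnTreeAt 3 κ 𝔭' γ (embAt K 3 𝔭' h𝔭' he' hf') P :=
    hC W N K Dt H ι P hO6 hsurj hr hN hK hHH hLt hP hnt (hKo N W K) κ hκ γ 𝔭' h𝔭' he' hf'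
  -- T-B6-1 at slack `v₃(c)` at the frame `(κ, 𝔭′, γ)` (K1 door, StepLEquivBranch §1)
  have himc : SchneiderFree.AdditiveIMCLowerBDPOnTreeLeAt 3 κ 𝔭' γ (embAt K 3 𝔭' h𝔭' he' hf')
      (padicValNat 3 Dt.c.natAbs) P :=
    SchneiderFreeAdditiveX3.additiveIMCLowerBDPOnTreeLeAt_of_indexLowerBoundLeAt_of_control hN hK hHH hfin hlo hctl
  -- the value display read at `𝔭′` (rank one), then Tight §2
  have hval' := (SchneiderFreeAdditiveX3.hasValueAt_sq_logOmega_embAt_iff_of_rank_one W 3 hK.1 hrk h𝔭 he hf h𝔭'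
    he' hf' P _ _ L).mpr hval
  exact WildSplitEisensteinInclusionAtThreeTight.norm_constantCoeff_le_of_imcLowerLe Dt.maninConstant_ne_zero_holds
    (X11b.R1.logOmega_ne_zero W 3 _ hnt) himc u hval' hfI

/-! ### §3 The normal form: modulo {Kolyvagin, W, PT1, C}, `E_𝟙^V ⟺ L₃ʷ°` -/

/-- **STEP-L NORMAL FORM of crux #2″.** Granted Kolyvagin's theorem, the printed frame inputs W (24476), PT1 (20461)
and the control equality C (20386) — all print-side items of the cell — the new crux `E_𝟙^V` (by name) is EQUIVALENT
to the STEP-L socket at the Manin slack on the odd Friedberg–Hoffstein data, `L₃ʷ°` (displayed). So `E_𝟙^V`'s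
content is exactly the `3`-part-of-BSD lower bound over `K` in Heegner-index currency; the BDP `L`-function, the frame,
the branch `ι′`, the unit `u` and the Λ-module `X_(∅,0)` carry no additional assertion. CONDITIONAL bookkeeping.
[cite: JetchevSkinnerWan2017, Thm. 3.3.1 and §7.4.1 (arXiv:1512.06894 pp. 11, 30)] -/
theorem valueAtOneV_iff_stepL
    (hKo : ∀ (N : ℕ) [NeZero N] (W : WeierstrassCurve ℚ) (K : Type) [Field K] [NumberField K],
      Literature.NumberTheory.EllipticCurves.kolyvagin N W K)
    (hW : WildSplitPrintedInputsAtThree) (hPT : PoitouTateSelmerStructureDualityFact) (hC : WildSplitControlAtThree) :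
    WildSplitEisensteinValueAtOneV ↔
      ∀ (W : WeierstrassCurve ℚ) [W.IsElliptic] [W.IsGloballyMinimal] (N : ℕ) [NeZero N] (K : Type) [Field K]
        [NumberField K] (Dt : ModularParametrizationData W N) (H : HeegnerDatum N (NumberField.discr K)) (ι : K →+* ℂ)
        (P : (W.baseChange K).toAffine.Point), ClassO6 W 3 → W.HasSurjectiveModNGaloisRep 3 → W.analyticRank = 1 →
        W.conductorNorm ℤ = N → IsImaginaryQuadratic K → SatisfiesHeegnerHypothesis N K →
        (W.quadraticTwist (NumberField.discr K : ℚ)).entireLFunction 1 ≠ 0 →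
        WeierstrassCurve.Affine.Point.map ι.toRatAlgHom P = heegnerPointComplex Dt H → ¬ IsOfFinAddOrder P →
        Odd (NumberField.discr K) → SchneiderFree.IndexLowerBoundLeAt W 3 K P (padicValNat 3 Dt.c.natAbs) :=
  ⟨fun hE1V ↦ stepL_of_valueAtOneV hE1V hKo hW hPT, fun hL ↦ valueAtOneV_of_stepL_of_control hL hKo hC⟩

/-! ### §4 The `W`-free kernel: the rung from `L₃ʷ°` and the Kolyvagin column, no frame, no BDP `L`-function -/

/-- **`PublishedInputsWildThree → L₃ʷ° → KolyvaginPrimitivesAtThree → JetchevMaxDivisibilityAtThreeModThree →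
WildSigmaDivisibilityAtThreeMultiCarrier → PoitouTateSelmerStructureDualityFact → WildRankZeroTwistAtThree →
WAllExclAddWildRankOneSurj`** — the act-G′-V `closes` kernel (p609065 §3 / p613203) with its Eisenstein step fed by
the STEP-L socket `L₃ʷ°` DIRECTLY: parity ⟹ `w(E) = −1`; Friedberg–Hoffstein with auxiliary modulus `2` ⟹ an odd
Heegner field `K` with `L(E^{(d_K)},1) ≠ 0` (so `d_K ≠ −3`, `3` split); the Heegner point `P` of infinite order
(Gross–Zagier); `hlo := L₃ʷ°` at that datum; the upper socket from the tower-free Kolyvagin crux Ko′, itself from the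
three McCallum-road primitives + Jetchev's max-form mod `3` (derived `hJmax hPT hE0 h372`) + `J‴` (soed-p2's p598295);
terminal step p528981 with the rank-zero leaf Z on the twist. NO frame `(κ, γ, 𝔭, 𝔭′, ι′)`, NO `R₀`-frame, NO value
display, NO control theorem on the `E`-side: the binder W 24476 and item 24475 do not enter, and PT enters only through
the Jetchev max-form glue. So, for the rung, crux #2 may be read in index currency. CONDITIONAL on every displayed
antecedent (`L₃ʷ°`, `J‴`, the Jetchev max-form at `3 ∣ N`, Z are research / tree debt; the rest is print); closes nothing;
BSD₃ is proved for no curve. [cite: JetchevSkinnerWan2017, §7.4.1 (arXiv:1512.06894 p. 30)]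
[cite: GrossZagier1986, Thm. I.(6.3) and V.§2] [cite: FriedbergHoffstein1995, Thm. B] [cite: McCallumLMS1991, §3]
[cite: GrossLMS1991, Prop. 3.7(2) and §6] [cite: Jetchev2008, Thm. 1.4] -/
theorem wAllExclAddWildRankOneSurj_of_stepL_of_sigmaMultiCarrier_of_jetchevMaxModThree_of_primitives_of_poitouTate
    (hF : PublishedInputsWildThree)
    (hL : ∀ (W : WeierstrassCurve ℚ) [W.IsElliptic] [W.IsGloballyMinimal] (N : ℕ) [NeZero N] (K : Type) [Field K]
      [NumberField K] (Dt : ModularParametrizationData W N) (H : HeegnerDatum N (NumberField.discr K)) (ι : K →+* ℂ)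
      (P : (W.baseChange K).toAffine.Point), ClassO6 W 3 → W.HasSurjectiveModNGaloisRep 3 → W.analyticRank = 1 →
      W.conductorNorm ℤ = N → IsImaginaryQuadratic K → SatisfiesHeegnerHypothesis N K →
      (W.quadraticTwist (NumberField.discr K : ℚ)).entireLFunction 1 ≠ 0 →
      WeierstrassCurve.Affine.Point.map ι.toRatAlgHom P = heegnerPointComplex Dt H → ¬ IsOfFinAddOrder P →
      Odd (NumberField.discr K) → SchneiderFree.IndexLowerBoundLeAt W 3 K P (padicValNat 3 Dt.c.natAbs))
    (hPr : KolyvaginPrimitivesAtThree)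
    (hJmax : JetchevMaxDivisibilityAtThreeModThree)
    (hJ : WildSigmaDivisibilityAtThreeMultiCarrier)
    (hPT : PoitouTateSelmerStructureDualityFact)
    (hZ : WildRankZeroTwistAtThree) :
    Summit.BirchSwinnertonDyer.WAllExclAddWildRankOneSurj := by
  -- the tower-free Kolyvagin upper bound Ko′ from the primitives + Jetchev max-form mod 3 + J‴ (soed-p2, p598295)
  obtain ⟨hCT, h372, hE0⟩ := hPr
  have hKoly : WildKolyvaginUpperAtThreeTowerFree :=
    WildKolyvaginUpperAtThreeTowerFreePrintClosedSubcells.wildKolyvaginUpperAtThreeTowerFree_of_sigmaMultiCarrier_of_jetchevMaxModThree_of_threePrimitives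
      hCT h372 hE0 (hJmax hPT hE0 h372) hJ
  unfold Summit.BirchSwinnertonDyer.WAllExclAddWildRankOneSurj
  intro W _ _ hncm hO6 hsurj hr
  obtain ⟨hGZ, hKo, hGZK, hmod, hmodP, -, hGZ73, hFH, hpar, hHP⟩ := hF
  haveI hN0 : NeZero (W.conductorNorm ℤ) := ⟨W.conductorNorm_pos_holds.ne'⟩
  -- (a) DATA. parity: `r_an = 1` is odd, so `w(E) = -1`
  have hw : W.rootNumber = -1 := by
    rcases W.rootNumber_eq_one_or with h | h
    · exfalso
      have heven : Even W.analyticRank := (hpar W).mpr h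
      rw [hr] at heven
      exact Nat.not_even_one heven
    · exact h
  -- Friedberg–Hoffstein with auxiliary modulus `2`: Heegner for `N(E)`, `2` split, `L(E^{(d_K)},1) ≠ 0`
  obtain ⟨K, _, _, hK, -, hHN, hH2, hLt⟩ := hFH W hw 2 two_ne_zero 0
  have hodd : Odd (NumberField.discr K) := by
    have h8 := Literature.SatisfiesHeegnerHypothesis.discr_emod_eight hK.1 hH2 (dvd_refl 2)
    rw [Int.odd_iff]; omega
  -- `3 ∣ N(E)` (additive) splits in `K`; hence `d_K ≠ -3`
  have h3N : 3 ∣ W.conductorNorm ℤ :=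
    (W.dvd_conductorNorm_iff_not_hasGoodReductionAtPrime 3).mpr (not_good_of_addv W 3 hO6.2.1)
  have hd3 : NumberField.discr K ≠ -3 := by
    intro h
    exact Literature.SatisfiesHeegnerHypothesis.not_dvd_discr hK.1 hHN Nat.prime_three h3N
      (by rw [h]; norm_num)
  -- the Heegner point over `K` and its datum; non-torsion by Gross–Zagier
  obtain ⟨P, Dt, H, ι, hP⟩ := hHP W K hK hHN
  have hL0 : W.entireLFunction 1 = 0 := entireLFunction_one_eq_zero_of_analyticRank_eq_one hr
  obtain ⟨-, hderiv⟩ := leadingLCoeff_eq_deriv_of_analyticRank_eq_one hr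
  have hLK : LDerivEK W K ≠ 0 := by
    rw [lDerivEK_eq_deriv_mul W K hmod hL0]; exact mul_ne_zero hderiv hLt
  have hnt : ¬ IsOfFinAddOrder P :=
    (lDerivEK_ne_zero_iff_not_isOfFinAddOrder W (W.conductorNorm ℤ) K (hGZ _ W K) hK hHN
      ⟨Dt, H, ι, hP⟩).mp hLK
  -- (b) THE TWO SOCKETS at slack `v₃(c)`: the LOWER one IS `L₃ʷ°` at this datum; the UPPER one is Ko′
  have hlo : SchneiderFree.IndexLowerBoundLeAt W 3 K P (padicValNat 3 Dt.c.natAbs) :=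
    hL W (W.conductorNorm ℤ) K Dt H ι P hO6 hsurj hr rfl hK hHN hLt hP hnt hodd
  have hupI : SchneiderFree.Upper.IndexUpperBoundLeAt W 3 K P (padicValNat 3 Dt.c.natAbs) :=
    hKoly W (W.conductorNorm ℤ) K Dt H ι P hO6 hsurj hr rfl hK hHN hLt hP hnt hodd hd3
  -- (c) TERMINAL STEP: a globally minimal model of the twist, then p528981
  have hD0 : (NumberField.discr K : ℚ) ≠ 0 := by exact_mod_cast NumberField.discr_ne_zero K
  haveI : (W.quadraticTwist (NumberField.discr K : ℚ)).IsElliptic := W.isElliptic_quadraticTwist hD0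
  obtain ⟨Cd, hCd⟩ := hasGlobalMinimalModel_rat_holds (W.quadraticTwist (NumberField.discr K : ℚ))
  haveI : (Cd • W.quadraticTwist (NumberField.discr K : ℚ)).IsGloballyMinimal := hCd
  exact SchneiderFree.Exact.bsdp_three_of_exactIndexManin_of_wAllExclAddWildRankZero hGZ hKo hGZK hmod
    hGZ73 hZ W hO6 hsurj hr (W.conductorNorm ℤ) K Dt H ι P
    (Cd • W.quadraticTwist (NumberField.discr K : ℚ)) rfl hK hodd hHN hLt hP ⟨Cd, rfl⟩ hlo hupI

end Summit.BirchSwinnertonDyer.BirchSwinnertonDyer.Theorems.WildSplitEisensteinValueAtOneVStepLNormalForm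

end
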